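import Mathlib
import Literature.NumberTheory.Transcendental.PreBlochGroup
import Literature.NumberTheory.Transcendental.BlochWignerDilogarithm
import Literature.NumberTheory.Transcendental.BlochGroupRegulator
import Literature.NumberTheory.Transcendental.PreBlochRelationCriterion
import HarnessLib

/-!
# Dupont, Thm. 10.24 a): reduction to Borel's regulator theorem and Suslin's theorem

NumberTheory/Transcendental proof file (no new definitions, no new named facts) for the named fact
`Literature.NumberTheory.Transcendental.Dupont2001_preBloch_relation_of_invariants`
(`PreBlochRelationCriterion.lean`; J. L. Dupont, *Scissors congruences, group homology and
characteristic classes* (2001), **Thm. 10.24 a)**: for `zᵢ ∈ ℚ̄ ∖ {0,1}`, `Σᵢ {zᵢ} = 0` holds in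
`𝒫_ℚ̄` iff (i) `Σᵢ λ{zᵢ} = 0` and (ii) `Σᵢ 𝒟(α zᵢ) = 0` for all `α ∈ Gal(ℚ̄/ℚ)`).

**The printed proof** (Dupont 2001, Ch. 10, "and we conclude:" after Cor. 10.21). By the
Bloch–Wigner–Suslin sequence (Thm. 8.19) an element of `𝒫_ℚ̄` with `λ = 0` lifts to
`H₃(Sl(2, ℚ̄))`; the twisted Borel regulators `r₂^α`, `α ∈ Gal(ℚ̄/ℚ)` — defined through the direct
limit `ℚ̄ = lim K` over number fields `K` ((10.17)) and given on `𝒫` by the Galois-twisted volumes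
`𝒟 ∘ α` (Thm. 10.2, (10.23)) — vanish on the lift by (ii); by BOREL's theorem (Thm. 10.18: "The
regulator map `𝐫` induces an injective map on `H_*(Sl(∞, ℚ̄), ℚ)`") the lift is torsion, and by
SUSLIN (Cor. 9.23 / Cor. 10.21, Thm. 8.16) the torsion `ℚ/ℤ = H₃(μ_ℚ̄)` dies in `𝒫_ℚ̄`, which is
uniquely divisible.

**What is proved here.** Exactly this deduction, in the vocabulary of the tree, from the two deep
inputs as they are already vendored (both are named facts WITHOUT discharge at the time of writing,
so the fact of `PreBlochRelationCriterion.lean` stays a fact; this file turns their discharges into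
its discharge):

* `Borel1977_blochGroup_regulator_kernel_torsion` (`BlochGroupRegulator.lean`; Neumann 1998
  Thm. 3.2 after Borel 1977 + Suslin 1991): over a NUMBER FIELD `K`, an element of `ℤ⟨K ∖ {0,1}⟩`
  with rationally vanishing Dehn invariant and vanishing regulator components `Σ nᵢ D(σ zᵢ)`
  (all `σ : K → ℂ`) has torsion class in `P(K)` — Borel's theorem enters Dupont's (10.17)/(10.18)
  precisely through the number fields `K ⊂ ℚ̄`;
* `Suslin1991_preBloch_isUniquelyDivisible` (`PreBlochGroup.lean`; Dupont Thm. 8.16 after Suslin):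
  `P(F)` is uniquely divisible for `F` algebraically closed of characteristic `0`.

The glue (§2, `Dupont2001_preBloch_relation_of_invariants_of_borel_suslin`) is the descent
`ℚ̄ → K = ℚ(z₁, …, z_k)` implicit in (10.17): additive characters `Kˣ → ℚ` extend to `Fˣ → ℚ`
(`ℚ` is divisible, Baer), embeddings `K → ℂ` extend to `F → ℂ` (`F/K` algebraic, `ℂ`
algebraically closed), so hypotheses (i), (ii) over `F` give Neumann's hypotheses over `K`; the
torsion multiple `N • ξ` then lies in the five-term span of `K`, which pushes forward into that of
`F` (§1, functoriality of the presentation), and unique divisibility removes `N`.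

## References

* J. L. Dupont, *Scissors congruences, group homology and characteristic classes*, Nankai Tracts in
  Math. 1, World Scientific 2001: Thm. 8.16, Thm. 8.19, (10.17), Thm. 10.18, Cor. 10.21, (10.23),
  Thm. 10.24. [`Dupont2001`]
* W. D. Neumann, *Hilbert's 3rd problem and invariants of 3-manifolds*, Geom. Topol. Monogr. 1
  (1998): eq. (2.3), Thm. 3.2. [`Neumann1998`]
* A. Borel, Ann. Sc. Norm. Super. Pisa (4) 4 (1977) 613–636. [`Borel1977`]
* A. A. Suslin, *`K₃` of a field, and the Bloch group*, Proc. Steklov Inst. Math. 183 (1991).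
  [`Suslin1991`]
-/

noncomputable section

namespace Literature.NumberTheory.Transcendental

open FreeAbelianGroup (of lift_apply_of)

/-! ### §1 Functoriality of the presentation along a field embedding -/

namespace PreBloch

variable {K L : Type*} [Field K] [Field L]

/-- Two generators of `ℤ⟨K ∖ {0,1}⟩` with the same value are equal.
[cite: Neumann1998, eq. (2.3)] -/
theorem Gen.ext_val {g g' : Gen K} (h : g.val = g'.val) : g = g' := Subtype.ext h

/-- A field embedding `f : K → L` maps `K ∖ {0,1}` into `L ∖ {0,1}`. [folklore] -/
theorem Gen.map_val_ne (f : K →+* L) (g : Gen K) : f g.val ≠ 0 ∧ f g.val ≠ 1 :=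
  ⟨(map_ne_zero f).2 g.val_ne_zero, fun h => g.val_ne_one (f.injective (by rw [h, map_one]))⟩

/-- Every additive character `Kˣ → ℚ` extends along a field embedding `f : K → L` to an additive
character `Lˣ → ℚ` (`ℚ` is a divisible, hence injective, `ℤ`-module — Baer's criterion).
[folklore] -/
theorem exists_addChar_extension (f : K →+* L) (uK : Additive Kˣ →+ ℚ) :
    ∃ u : Additive Lˣ →+ ℚ, ∀ x : Kˣ,
      u (Additive.ofMul (Units.map (f : K →* L) x)) = uK (Additive.ofMul x) := by
  have hinj : Function.Injective (MonoidHom.toAdditive (Units.map (f : K →* L))) := by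
    intro a b hab
    have hab' : Units.map (f : K →* L) (Additive.toMul a) =
        Units.map (f : K →* L) (Additive.toMul b) := hab
    exact congrArg Additive.ofMul (Units.map_injective f.injective hab')
  obtain ⟨u, hu⟩ := (Module.Baer.of_divisible ℚ).extension_property_addMonoidHom _ hinj uK
  exact ⟨u, fun x => by simpa using DFunLike.congr_fun hu (Additive.ofMul x)⟩

/-- **Functoriality of the five-term span.** For a field embedding `f : K → L` and any additive map
`ι : ℤ⟨K ∖ {0,1}⟩ → ℤ⟨L ∖ {0,1}⟩` with `ι [z] = [f z]`, the image of every five-term relator of `K`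
is the five-term relator of `L` at `(f x, f y)`; hence `ι` maps the five-term span of `K` into that
of `L` (i.e. `[z] ↦ [f z]` induces `P(K) → P(L)`). [cite: Neumann1998, eq. (2.3)] -/
theorem closure_fiveTermRelators_le_comap (f : K →+* L)
    (ι : FreeAbelianGroup (Gen K) →+ FreeAbelianGroup (Gen L))
    (hι : ∀ (g : Gen K) (g' : Gen L), g'.val = f g.val → ι (of g) = of g') :
    AddSubgroup.closure (fiveTermRelators K) ≤
      (AddSubgroup.closure (fiveTermRelators L)).comap ι := by
  refine (AddSubgroup.closure_le _).2 ?_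
  rintro r ⟨x, y, hxy, rfl⟩
  obtain ⟨x', hx'⟩ : ∃ x' : Gen L, x'.val = f x.val := ⟨⟨f x.val, Gen.map_val_ne f x⟩, rfl⟩
  obtain ⟨y', hy'⟩ : ∃ y' : Gen L, y'.val = f y.val := ⟨⟨f y.val, Gen.map_val_ne f y⟩, rfl⟩
  have hxy' : x'.val ≠ y'.val := fun e => hxy (f.injective (by rw [← hx', ← hy', e]))
  have h1 : ι (of x) = of x' := hι x x' hx'
  have h2 : ι (of y) = of y' := hι y y' hy'
  have h3 : ι (of (Gen.quot x y hxy)) = of (Gen.quot x' y' hxy') :=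
    hι _ _ (by rw [Gen.val_quot, Gen.val_quot, map_div₀, hx', hy'])
  have h4 : ι (of (Gen.quotInv x y hxy)) = of (Gen.quotInv x' y' hxy') :=
    hι _ _ (by rw [Gen.val_quotInv, Gen.val_quotInv, map_div₀, map_sub, map_sub, map_one,
      map_inv₀, map_inv₀, hx', hy'])
  have h5 : ι (of (Gen.quotSub x y hxy)) = of (Gen.quotSub x' y' hxy') :=
    hι _ _ (by rw [Gen.val_quotSub, Gen.val_quotSub, map_div₀, map_sub, map_sub, map_one, hx', hy'])
  have key : ι (fiveTermRelator K x y hxy) = fiveTermRelator L x' y' hxy' := by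
    simp only [fiveTermRelator, map_add, map_sub, h1, h2, h3, h4, h5]
  show ι (fiveTermRelator K x y hxy) ∈ AddSubgroup.closure (fiveTermRelators L)
  rw [key]
  exact AddSubgroup.subset_closure ⟨x', y', hxy', rfl⟩

end PreBloch

/-! ### §2 Extension of embeddings and the reduction -/

/-- Every ring embedding `σ : K → ℂ` of an intermediate field `K` of an algebraic extension `F/ℚ`
extends to `F` (`F/K` is algebraic and `ℂ` is algebraically closed). [folklore] -/
theorem exists_ringHom_extension_of_isAlgebraic {F : Type*} [Field F] [Algebra ℚ F]
    [Algebra.IsAlgebraic ℚ F] (K : IntermediateField ℚ F) (σ : K →+* ℂ) :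
    ∃ τ : F →+* ℂ, ∀ x : K, τ (algebraMap K F x) = σ x := by
  letI : Algebra K ℂ := σ.toAlgebra
  haveI : Module.IsTorsionFree K ℂ := DivisionSemiring.to_moduleIsTorsionFree
  haveI : Module.IsTorsionFree K F := DivisionSemiring.to_moduleIsTorsionFree
  haveI : Algebra.IsAlgebraic K F := Algebra.IsAlgebraic.tower_top (K := ℚ) K
  let τ : F →ₐ[K] ℂ := IsAlgClosed.lift
  exact ⟨τ.toRingHom, fun x => (τ.commutes x).trans rfl⟩

/-- **The descent** (Dupont (10.17): `ℚ̄ = lim K` over number fields). For `F` algebraically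
closed of characteristic `0` and algebraic over `ℚ` (with its canonical `ℚ`-algebra structure), the
conclusion of Thm. 10.24 a) for `Σ mᵢ [zᵢ]` follows from Borel's theorem over the number field
`K = ℚ(z₁, …, z_k)` and Suslin's theorem for `P(F)`: characters `Kˣ → ℚ` and embeddings `K → ℂ`
extend to `F`, so hypotheses (i), (ii) over `F` give the Bloch condition and the vanishing of all
regulator components over `K`; Borel puts `N • ξ` (`N ≥ 1`) in the five-term span of `K`,
functoriality moves it to `F`, and unique divisibility of `P(F)` removes `N`.
[cite: Dupont2001, Thm. 10.24 a)] -/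
theorem mem_closure_fiveTermRelators_of_invariants_of_borel_suslin
    (hBorel : Borel1977_blochGroup_regulator_kernel_torsion)
    (hSuslin : Suslin1991_preBloch_isUniquelyDivisible)
    (F : Type) [Field F] [CharZero F] [IsAlgClosed F] [Algebra.IsAlgebraic ℚ F]
    {k : ℕ} (z : Fin k → F) (m : Fin k → ℤ) (hz : ∀ i, z i ≠ 0 ∧ z i ≠ 1)
    (hsym : ∀ u v : Additive Fˣ →+ ℚ,
        ∑ i, (m i : ℚ) * (u (Additive.ofMul (Units.mk0 (z i) (hz i).1)) *
              v (Additive.ofMul (Units.mk0 (1 - z i) (sub_ne_zero.2 (hz i).2.symm))) -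
            v (Additive.ofMul (Units.mk0 (z i) (hz i).1)) *
              u (Additive.ofMul (Units.mk0 (1 - z i) (sub_ne_zero.2 (hz i).2.symm)))) = 0)
    (hvol : ∀ σ : F →+* ℂ, ∑ i, (m i : ℝ) * blochWignerDilog (σ (z i)) = 0) :
    (∑ i, m i • of (⟨z i, hz i⟩ : PreBloch.Gen F)) ∈ AddSubgroup.closure (fiveTermRelators F) := by
  -- the number field `K = ℚ(z₁, …, z_k) ⊆ F`
  let S : Set F := Set.range z
  let K : IntermediateField ℚ F := IntermediateField.adjoin ℚ S
  haveI : Finite S := (Set.finite_range z).to_subtype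
  haveI hfd : FiniteDimensional ℚ K := IntermediateField.finiteDimensional_adjoin
    (fun x _ => (Algebra.IsAlgebraic.isAlgebraic (R := ℚ) x).isIntegral)
  haveI : NumberField K := { to_charZero := inferInstance, to_finiteDimensional := hfd }
  have hzK : ∀ i, z i ∈ K := fun i => IntermediateField.subset_adjoin ℚ S ⟨i, rfl⟩
  -- the generators `[zᵢ]` of `ℤ⟨K ∖ {0,1}⟩` and the element `ξ_K = Σ mᵢ [zᵢ]`
  have hg : ∀ i, (⟨z i, hzK i⟩ : K) ≠ 0 ∧ (⟨z i, hzK i⟩ : K) ≠ 1 := fun i =>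
    ⟨fun h => (hz i).1 (by simpa using congrArg (fun x : K => (x : F)) h),
      fun h => (hz i).2 (by simpa using congrArg (fun x : K => (x : F)) h)⟩
  let g : Fin k → PreBloch.Gen K := fun i => ⟨⟨z i, hzK i⟩, hg i⟩
  let ξK : FreeAbelianGroup (PreBloch.Gen K) := ∑ i, m i • of (g i)
  let f : K →+* F := algebraMap K F
  have hf : ∀ i, f (g i).val = z i := fun i => rfl
  -- (1) the Bloch condition over `K`, from hypothesis (i) over `F`
  have hW : ∀ uK vK : Additive Kˣ →+ ℚ, PreBloch.wedgePairing uK vK ξK = 0 := by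
    intro uK vK
    obtain ⟨u, hu⟩ := PreBloch.exists_addChar_extension f uK
    obtain ⟨v, hv⟩ := PreBloch.exists_addChar_extension f vK
    have hunit : ∀ i, Units.map (f : K →* F) (g i).unit = Units.mk0 (z i) (hz i).1 :=
      fun i => Units.ext (hf i)
    have hunit' : ∀ i, Units.map (f : K →* F) (g i).unitOneSub =
        Units.mk0 (1 - z i) (sub_ne_zero.2 (hz i).2.symm) := fun i =>
      Units.ext (by
        simp only [Units.coe_map, MonoidHom.coe_coe, PreBloch.Gen.val_unitOneSub, map_sub,
          map_one, hf, Units.val_mk0])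
    have key : PreBloch.wedgePairing uK vK ξK =
        -∑ i, (m i : ℚ) * (u (Additive.ofMul (Units.mk0 (z i) (hz i).1)) *
              v (Additive.ofMul (Units.mk0 (1 - z i) (sub_ne_zero.2 (hz i).2.symm))) -
            v (Additive.ofMul (Units.mk0 (z i) (hz i).1)) *
              u (Additive.ofMul (Units.mk0 (1 - z i) (sub_ne_zero.2 (hz i).2.symm)))) := by
      simp only [ξK, map_sum, map_zsmul, PreBloch.wedgePairing_of, zsmul_eq_mul, ← hu, ← hv,
        hunit, hunit', ← Finset.sum_neg_distrib]
      refine Finset.sum_congr rfl fun i _ => ?_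
      ring
    rw [key, hsym u v, neg_zero]
  -- (2) every regulator component over `K` vanishes, from hypothesis (ii) over `F`
  have hR : ∀ σ : K →+* ℂ, PreBloch.regulatorAt σ ξK = 0 := by
    intro σ
    obtain ⟨τ, hτ⟩ := exists_ringHom_extension_of_isAlgebraic K σ
    have hσ : ∀ i, σ (g i).val = τ (z i) := fun i => by rw [← hf i, ← hτ]
    have key : PreBloch.regulatorAt σ ξK = ∑ i, (m i : ℝ) * blochWignerDilog (τ (z i)) := by
      simp only [ξK, map_sum, map_zsmul, PreBloch.regulatorAt_of, zsmul_eq_mul, hσ]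
    rw [key]
    exact hvol τ
  -- (3) Borel: a positive multiple of `ξ_K` lies in the five-term span of `K`
  obtain ⟨N, hN, hNξ⟩ := hBorel K ξK hW hR
  have hmemK : N • ξK ∈ AddSubgroup.closure (fiveTermRelators K) := by
    rw [← PreBloch.proj_eq_zero_iff, map_nsmul]
    exact hNξ
  -- (4) push forward along `K ⊆ F` (functoriality, §1)
  let ι : FreeAbelianGroup (PreBloch.Gen K) →+ FreeAbelianGroup (PreBloch.Gen F) :=
    FreeAbelianGroup.lift fun x => of (⟨f x.val, PreBloch.Gen.map_val_ne f x⟩ : PreBloch.Gen F)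
  have hι : ∀ (x : PreBloch.Gen K) (x' : PreBloch.Gen F), x'.val = f x.val → ι (of x) = of x' := by
    intro x x' hx
    rw [lift_apply_of]
    exact congrArg of (PreBloch.Gen.ext_val hx.symm)
  have hpush := PreBloch.closure_fiveTermRelators_le_comap f ι hι hmemK
  rw [AddSubgroup.mem_comap, map_nsmul] at hpush
  have hιξ : ι ξK = ∑ i, m i • of (⟨z i, hz i⟩ : PreBloch.Gen F) := by
    simp only [ξK, map_sum, map_zsmul]
    exact Finset.sum_congr rfl fun i _ =>
      congrArg (fun t => m i • t) (hι (g i) ⟨z i, hz i⟩ (hf i).symm)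
  rw [hιξ] at hpush
  -- (5) Suslin: `P(F)` has no torsion
  exact hSuslin.mem_closure_of_nsmul_mem hN hpush

/-- **Dupont, Thm. 10.24 a), from Borel's theorem and Suslin's theorem.** If the Borel regulator
has torsion kernel on the Bloch group of every number field
(`Borel1977_blochGroup_regulator_kernel_torsion`; Dupont Thm. 10.18 after Borel 1977, in
Neumann's form, Thm. 3.2) and the pre-Bloch group of every algebraically closed field of
characteristic `0` is uniquely divisible (`Suslin1991_preBloch_isUniquelyDivisible`; Dupont
Thm. 8.16 after Suslin 1991), then relations in `P(ℚ̄)` are decided by the Dehn invariant and the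
Galois-twisted volumes (`Dupont2001_preBloch_relation_of_invariants`). The given `ℚ`-algebra
structure of an algebraic closure `F` of `ℚ` enters only through "`F` is algebraically closed and
algebraic over `ℚ`"; all `ℚ`-algebra structures on a field coincide, so the descent
(`mem_closure_fiveTermRelators_of_invariants_of_borel_suslin`) is run for the canonical one.
[cite: Dupont2001, Thm. 10.24 a)] -/
theorem Dupont2001_preBloch_relation_of_invariants_of_borel_suslin
    (hBorel : Borel1977_blochGroup_regulator_kernel_torsion)
    (hSuslin : Suslin1991_preBloch_isUniquelyDivisible) :
    Dupont2001_preBloch_relation_of_invariants := by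
  intro F _ _ _ k z m hz hsym hvol
  haveI : IsAlgClosed F := IsAlgClosure.isAlgClosed ℚ
  haveI : CharZero F := charZero_of_injective_algebraMap (algebraMap ℚ F).injective
  have halg : @Algebra.IsAlgebraic ℚ F _ _ DivisionRing.toRatAlgebra := by
    convert (IsAlgClosure.isAlgebraic : Algebra.IsAlgebraic ℚ F)
    exact Subsingleton.elim _ _
  exact @mem_closure_fiveTermRelators_of_invariants_of_borel_suslin hBorel hSuslin F _ _ _ halg
    k z m hz hsym hvol

end Literature.NumberTheory.Transcendental

end
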